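import Summits.HodgeConjecture.HodgeConjecture.Theorems.F0P3cStCharTSVanDijkHC    -- ★ (F0P3a-p07) «VDW-CORE»: `discr_prod_X_sub_C_fin_three`, `discr_charpoly_and_det_of_eq_diagonal`
import Mathlib.LinearAlgebra.Matrix.StdBasis
import Mathlib.LinearAlgebra.Determinant
import HarnessLib

/-!
# F0 · P3c · line LH6 «StCharTS» — ROAD «JAC-ELL» brick C7 (file 1 ∕ 3) «AD-REGULARISED DETERMINANT»: for a SPLIT regular semisimple `t = g·diag(d)·g⁻¹ ∈ GL_n(K)`,
# every operator that is `Ad_{t⁻¹} − 1` on `(Ad_t − 1)M_n(K)` and the identity on `𝔷(t)` has determinant `∏_{k≠l}(d_k⁻¹d_l − 1)`; for `n = 3` this is `−disc(χ_t)∕det(t)²`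
# (Harish-Chandra 1970 Lemma 22: the Jacobian `det((1 − Ad t)|_{𝔤∕𝔱})` of `(x, t) ↦ x t x⁻¹`; Rogawski 1990 §4.9 p. 54 `D_G`)

Cell `pub/hodgecm-mathlib`, crux H413 = `stmt-HodgeConjecture-24833` (lane `--supports … --as helper`), route HCCMUnconditional; seat LH6-p02 (g6), brick C7 «WEIGHT-ID
elliptic» of LH5-p02 (g6)'s road «JAC-ELL» (memo `F0/P3c/LH5/LH5-p02/g6/ROAD-JAC-ELL.v0.LH5p02g6.md` §1 row C7; dress «A′ + B + C» fixed by the road author F0∕P3c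
2026-09-02T15:05:53Z: C8's linear part is `L̃ := (Ad t₀⁻¹ − 1) ∘ pr_𝔪 + pr_𝔱 : 𝔤 ≃L[F] 𝔤`, block-diagonal on `𝔤 = 𝔪 ⊕ 𝔱`, and the weight enters as `|det L̃|_v = (𝔇.DG (ι t₀))²`).
THEOREMS ONLY (no definition ∕ instance ∕ notation ∕ named fact ∕ `sorry`); imports ★ VanDijkHC (the `Fin 3` discriminant bookkeeping) + Mathlib.
HONEST LABEL: HC_CM is proved only modulo the 7 printed citations (2 remaining: hLiu418 = `stmt-HodgeConjecture-24832`, h413 = `stmt-HodgeConjecture-24833`) until rung 0 closes;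
count-neutral algebra for the ELLIPTIC half of the print residue «WIF» of the (S-𝔇) organ `stub_EllipticPackage` of `Cruxes/H413/Lines/F0_P3c_StCharTSPaydown.lean`; closes no organ.

THE MATHEMATICS (any field `K`, `n` finite; file 1 = the case where `t` is diagonalisable OVER `K`; file 2 descends from a splitting field, file 3 is the `F`-form ∕ norm dress).
For `t = g·D·g⁻¹`, `D = diag(d)`, `dᵢ` pairwise distinct, the operator `Ad_t : X ↦ tXt⁻¹` on `M_n(K)` is semisimple with eigenvectors `g E_{kl} g⁻¹`, eigenvalues `d_k d_l⁻¹`;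
`𝔷(t) = ker(Ad_t − 1)` is spanned by the `g E_{kk} g⁻¹` and `𝔪 := (Ad_t − 1)M_n(K)` by the `g E_{kl} g⁻¹`, `k ≠ l`.  A **regularised Jacobian operator** is any `K`-linear `Φ`
with `Φ ∘ (Ad_t − 1) = (Ad_{t⁻¹} − 1) ∘ (Ad_t − 1)` (`h1`: `Φ = Ad_{t⁻¹} − 1` on `𝔪`) and `Φ Z = Z` whenever `Zt = tZ` (`h2`) — e.g. C8's `L̃ = (Ad t⁻¹ − 1) ∘ pr_𝔪 + pr_𝔷`
extended `K`-linearly.  Then `Φ(gE_{kl}g⁻¹) = (d_k⁻¹d_l − 1 + [k = l])·gE_{kl}g⁻¹`, i.e. `Φ = Ad_g ∘ Φ_d ∘ Ad_g⁻¹` with the EXPLICIT model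
`Φ_d := (Ad_{D⁻¹} − 1) + diagonal ∘ diag` (diagonal in the standard basis), so `det Φ = det Φ_d = ∏_{(k,l)} (d_k⁻¹d_l − 1 + [k = l])` (`LinearMap.det_conj`), and for `n = 3`
`∏_{k≠l}(d_k⁻¹d_l − 1) = ∏_{k<l} −(d_k − d_l)²∕(d_kd_l) = −disc(χ_t)∕det(t)²` (★ `discr_charpoly_and_det_of_eq_diagonal`, `Matrix.charpoly_units_conj`, `Matrix.det_conj`).
* §1 `phi_single`, `det_phi_diagonal` (the model operator on matrix units and its determinant, any `n`), `diagonal_mul_single_mul_diagonal`, `conj_mul_conj_mul_conj`,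
  **`det_eq_prod_of_eq_conj_diagonal`** (any `n`: `det Φ = ∏ (d_k⁻¹d_l − 1 + [k = l])`);
* §2 (`n = 3`) `prod_phi_eigenvalues_fin_three`, `det_phi_diagonal_fin_three`, **`det_eq_neg_discr_div_det_sq_of_eq_conj_diagonal`** (`det Φ = −disc(χ_t)∕det(t)²`).

## References
* [HarishChandra1970] Harish-Chandra, *Harmonic analysis on reductive p-adic groups*, LNM 162 (1970), Lemma 22 (the Jacobian `|det((1 − Ad t)|_{𝔤∕𝔱})|` of `(x, t) ↦ x t x⁻¹`).
* [Rogawski1990] J. D. Rogawski, *Automorphic Representations of Unitary Groups in Three Variables*, Ann. of Math. Stud. 123 (1990), §4.9 p. 54 (`D_G(γ) = |∏(1 − α(γ))|^{1∕2}`),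
  §12.5 p. 182 (Weyl integration formula).
-/

set_option autoImplicit false
-- the mandated namespace has the single-problem summit's repeated segment (`HodgeConjecture.HodgeConjecture`)
set_option linter.dupNamespace false

noncomputable section

open Matrix Polynomial
open scoped MatrixGroups

namespace Summit.HodgeConjecture.HodgeConjecture.Cruxes.H413.F0P3cStCharTSAdRegularisedDet

/-! ## §1 The regularised operator `Φ_d := (Ad_{diag(d)⁻¹} − 1) + (diagonal part)` is diagonal in the standard basis `E_{kl}`, with eigenvalue `d_k⁻¹ d_l − 1 + [k = l]` -/

section AnyField

variable {K : Type*} [Field K] {n : Type*} [Fintype n] [DecidableEq n]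

/-- Entrywise action of `X ↦ diag(d)⁻¹ · X · diag(d) − X + diagonal(diag X)` on the matrix unit `E_{kl}`:
it is the scalar `d_k⁻¹ d_l − 1 + [k = l]` times `E_{kl}`. [cite: HarishChandra1970, Lemma 22] -/
theorem phi_single (d : n → Kˣ) (k l : n) :
    ((LinearMap.mulLeftRight K ((diagonal fun i => (((d i)⁻¹ : Kˣ) : K)), diagonal fun i => ((d i : Kˣ) : K)) - LinearMap.id +
        (Matrix.diagonalLinearMap n K K ∘ₗ Matrix.diagLinearMap n K K) : Matrix n n K →ₗ[K] Matrix n n K)) (Matrix.single k l (1 : K)) =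
      ((((d k)⁻¹ * d l : Kˣ) : K) - 1 + if k = l then 1 else 0) • Matrix.single k l (1 : K) := by
  have hφ : ((LinearMap.mulLeftRight K ((diagonal fun i => (((d i)⁻¹ : Kˣ) : K)), diagonal fun i => ((d i : Kˣ) : K)) - LinearMap.id +
        (Matrix.diagonalLinearMap n K K ∘ₗ Matrix.diagLinearMap n K K) : Matrix n n K →ₗ[K] Matrix n n K)) (Matrix.single k l (1 : K)) =
      (diagonal fun i => (((d i)⁻¹ : Kˣ) : K)) * Matrix.single k l (1 : K) * (diagonal fun i => ((d i : Kˣ) : K)) - Matrix.single k l (1 : K) +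
        diagonal (diag (Matrix.single k l (1 : K))) := by
    simp only [LinearMap.add_apply, LinearMap.sub_apply, LinearMap.mulLeftRight_apply, LinearMap.id_apply, LinearMap.comp_apply]
    rfl
  rw [hφ]
  ext i j
  simp only [Matrix.add_apply, Matrix.sub_apply, Matrix.mul_diagonal, Matrix.diagonal_mul, Matrix.smul_apply, smul_eq_mul, Matrix.single_apply,
    Matrix.diagonal_apply, Matrix.diag_apply, Units.val_mul]
  by_cases h : k = i ∧ l = j
  · obtain ⟨rfl, rfl⟩ := h
    by_cases hkl : k = l
    · subst hkl
      simp
    · simp [hkl]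
  · simp only [if_neg h, mul_zero, sub_zero, zero_mul]
    by_cases hij : i = j
    · subst hij
      rw [if_pos rfl, if_neg h, add_zero]
    · rw [if_neg hij, add_zero]

/-- **`det Φ_d = ∏_{(k,l)} (d_k⁻¹ d_l − 1 + [k = l])`** for the regularised operator `Φ_d = (Ad_{diag(d)⁻¹} − 1) + (diagonal part)` on `M_n(K)` (diagonal in the
standard basis). [cite: HarishChandra1970, Lemma 22] -/
theorem det_phi_diagonal (d : n → Kˣ) :
    LinearMap.det ((LinearMap.mulLeftRight K ((diagonal fun i => (((d i)⁻¹ : Kˣ) : K)), diagonal fun i => ((d i : Kˣ) : K)) - LinearMap.id +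
        (Matrix.diagonalLinearMap n K K ∘ₗ Matrix.diagLinearMap n K K) : Matrix n n K →ₗ[K] Matrix n n K)) =
      ∏ p : n × n, ((((d p.1)⁻¹ * d p.2 : Kˣ) : K) - 1 + if p.1 = p.2 then 1 else 0) := by
  classical
  set Φ : Matrix n n K →ₗ[K] Matrix n n K :=
    LinearMap.mulLeftRight K ((diagonal fun i => (((d i)⁻¹ : Kˣ) : K)), diagonal fun i => ((d i : Kˣ) : K)) - LinearMap.id +
        (Matrix.diagonalLinearMap n K K ∘ₗ Matrix.diagLinearMap n K K) with hΦ
  have hmat : LinearMap.toMatrix (Matrix.stdBasis K n n) (Matrix.stdBasis K n n) Φ =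
      Matrix.diagonal fun p : n × n => ((((d p.1)⁻¹ * d p.2 : Kˣ) : K) - 1 + if p.1 = p.2 then 1 else 0) := by
    ext p q
    rw [LinearMap.toMatrix_apply, Matrix.stdBasis_eq_single, hΦ, phi_single, ← Matrix.stdBasis_eq_single, map_smul,
      Module.Basis.repr_self, Finsupp.smul_apply, Finsupp.single_apply, Matrix.diagonal_apply, smul_eq_mul]
    by_cases h : q = p
    · subst h; simp
    · rw [if_neg h, if_neg (Ne.symm h), mul_zero]
  rw [← LinearMap.det_toMatrix (Matrix.stdBasis K n n), hmat, Matrix.det_diagonal]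

/-- `diag(a) · E_{kl}(c) · diag(b) = E_{kl}(a_k c b_l)`. [folklore] -/
theorem diagonal_mul_single_mul_diagonal (a b : n → K) (k l : n) (c : K) :
    diagonal a * Matrix.single k l c * diagonal b = Matrix.single k l (a k * c * b l) := by
  ext i j
  simp only [Matrix.mul_diagonal, Matrix.diagonal_mul, Matrix.single_apply]
  by_cases h : k = i ∧ l = j
  · obtain ⟨rfl, rfl⟩ := h; simp
  · rw [if_neg h, if_neg h, mul_zero, zero_mul]

/-- Conjugation algebra: `(g A g⁻¹)(g X g⁻¹)(g B g⁻¹) = g (A X B) g⁻¹` for `g ∈ GL_n(K)`. [folklore] -/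
theorem conj_mul_conj_mul_conj (g : GL n K) (A X B : Matrix n n K) :
    ((g : Matrix n n K) * A * ((g⁻¹ : GL n K) : Matrix n n K)) * ((g : Matrix n n K) * X * ((g⁻¹ : GL n K) : Matrix n n K)) *
        ((g : Matrix n n K) * B * ((g⁻¹ : GL n K) : Matrix n n K)) =
      (g : Matrix n n K) * (A * X * B) * ((g⁻¹ : GL n K) : Matrix n n K) := by
  have hig : ((g⁻¹ : GL n K) : Matrix n n K) * (g : Matrix n n K) = 1 := by
    rw [← Units.val_mul, inv_mul_cancel, Units.val_one]
  calc ((g : Matrix n n K) * A * ((g⁻¹ : GL n K) : Matrix n n K)) * ((g : Matrix n n K) * X * ((g⁻¹ : GL n K) : Matrix n n K)) *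
        ((g : Matrix n n K) * B * ((g⁻¹ : GL n K) : Matrix n n K))
      = (g : Matrix n n K) * A * (((g⁻¹ : GL n K) : Matrix n n K) * (g : Matrix n n K)) * X *
          (((g⁻¹ : GL n K) : Matrix n n K) * (g : Matrix n n K)) * B * ((g⁻¹ : GL n K) : Matrix n n K) := by
        simp only [Matrix.mul_assoc]
    _ = (g : Matrix n n K) * (A * X * B) * ((g⁻¹ : GL n K) : Matrix n n K) := by
        rw [hig, Matrix.mul_one, Matrix.mul_one]; simp only [Matrix.mul_assoc]

/-- **SPLIT REGULAR SEMISIMPLE CASE of the C7 determinant.**  Let `t = g · diag(d) · g⁻¹ ∈ GL_n(K)` with pairwise distinct `dᵢ`, and let `Φ` be ANY `K`-linear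
operator on `M_n(K)` which is `Ad_{t⁻¹} − 1` on the image of `Ad_t − 1` (`h1`, an identity of operators) and the identity on the commutant of `t` (`h2`) — the
«regularised Jacobian operator» `(Ad_{t⁻¹} − 1)|_𝔪 ⊕ id_𝔷` of the tube map at `t` (`𝔪 = (Ad_t − 1)M_n(K)`, `𝔷 = 𝔷(t)`).  Then
`det Φ = ∏_{(k,l)} (d_k⁻¹ d_l − 1 + [k = l]) = ∏_{k ≠ l} (λ_k⁻¹λ_l − 1)`: `Φ = Ad_g ∘ Φ_d ∘ Ad_g⁻¹` (checked on the conjugated matrix units `g E_{kl} g⁻¹`, which for `k ≠ l`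
are `(Ad_t − 1)`-images and for `k = l` commute with `t`), and `det` is conjugation invariant. [cite: HarishChandra1970, Lemma 22] [cite: Rogawski1990, §4.9 p. 54; §12.5 p. 182] -/
theorem det_eq_prod_of_eq_conj_diagonal (t g : GL n K) (d : n → Kˣ) (hd : Function.Injective d)
    (ht : (t : Matrix n n K) = (g : Matrix n n K) * diagonal (fun i => ((d i : Kˣ) : K)) * ((g⁻¹ : GL n K) : Matrix n n K))
    (Φ : Matrix n n K →ₗ[K] Matrix n n K)
    (h1 : Φ ∘ₗ (LinearMap.mulLeftRight K ((t : Matrix n n K), ((t⁻¹ : GL n K) : Matrix n n K)) - LinearMap.id) =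
      (LinearMap.mulLeftRight K (((t⁻¹ : GL n K) : Matrix n n K), (t : Matrix n n K)) - LinearMap.id) ∘ₗ
        (LinearMap.mulLeftRight K ((t : Matrix n n K), ((t⁻¹ : GL n K) : Matrix n n K)) - LinearMap.id))
    (h2 : ∀ Z : Matrix n n K, Z * (t : Matrix n n K) = (t : Matrix n n K) * Z → Φ Z = Z) :
    LinearMap.det Φ = ∏ p : n × n, ((((d p.1)⁻¹ * d p.2 : Kˣ) : K) - 1 + if p.1 = p.2 then 1 else 0) := by
  classical
  set D : Matrix n n K := diagonal (fun i => ((d i : Kˣ) : K)) with hD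
  set Di : Matrix n n K := diagonal (fun i => (((d i)⁻¹ : Kˣ) : K)) with hDi
  have hgi : (g : Matrix n n K) * ((g⁻¹ : GL n K) : Matrix n n K) = 1 := by
    rw [← Units.val_mul, mul_inv_cancel, Units.val_one]
  have hig : ((g⁻¹ : GL n K) : Matrix n n K) * (g : Matrix n n K) = 1 := by
    rw [← Units.val_mul, inv_mul_cancel, Units.val_one]
  have hDiD : Di * D = 1 := by
    rw [hD, hDi, diagonal_mul_diagonal, ← diagonal_one]; congr 1; funext i; rw [← Units.val_mul, inv_mul_cancel, Units.val_one]
  -- `t⁻¹ = g · diag(d)⁻¹ · g⁻¹`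
  have hti : ((t⁻¹ : GL n K) : Matrix n n K) = (g : Matrix n n K) * Di * ((g⁻¹ : GL n K) : Matrix n n K) := by
    rw [Matrix.coe_units_inv, ht]
    refine Matrix.inv_eq_left_inv ?_
    calc (g : Matrix n n K) * Di * ((g⁻¹ : GL n K) : Matrix n n K) * ((g : Matrix n n K) * D * ((g⁻¹ : GL n K) : Matrix n n K))
        = (g : Matrix n n K) * Di * (((g⁻¹ : GL n K) : Matrix n n K) * (g : Matrix n n K)) * D * ((g⁻¹ : GL n K) : Matrix n n K) := by
          simp only [Matrix.mul_assoc]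
      _ = 1 := by rw [hig, Matrix.mul_one, Matrix.mul_assoc (g : Matrix n n K) Di D, hDiD, Matrix.mul_one, hgi]
  -- the conjugation equivalence `e = Ad_g`
  let e : Matrix n n K ≃ₗ[K] Matrix n n K :=
    LinearEquiv.ofLinear (LinearMap.mulLeftRight K ((g : Matrix n n K), ((g⁻¹ : GL n K) : Matrix n n K)))
      (LinearMap.mulLeftRight K (((g⁻¹ : GL n K) : Matrix n n K), (g : Matrix n n K)))
      (by
        apply LinearMap.ext; intro X
        simp only [LinearMap.coe_comp, Function.comp_apply, LinearMap.mulLeftRight_apply, LinearMap.id_apply]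
        rw [← Matrix.mul_assoc, ← Matrix.mul_assoc, hgi, Matrix.one_mul, Matrix.mul_assoc, hgi, Matrix.mul_one])
      (by
        apply LinearMap.ext; intro X
        simp only [LinearMap.coe_comp, Function.comp_apply, LinearMap.mulLeftRight_apply, LinearMap.id_apply]
        rw [← Matrix.mul_assoc, ← Matrix.mul_assoc, hig, Matrix.one_mul, Matrix.mul_assoc, hig, Matrix.mul_one])
  have he : ∀ X, e X = (g : Matrix n n K) * X * ((g⁻¹ : GL n K) : Matrix n n K) := fun X => rfl
  -- the diagonal model operator `Φ_d`
  set Φd : Matrix n n K →ₗ[K] Matrix n n K :=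
    LinearMap.mulLeftRight K ((diagonal fun i => (((d i)⁻¹ : Kˣ) : K)), diagonal fun i => ((d i : Kˣ) : K)) - LinearMap.id +
      (Matrix.diagonalLinearMap n K K ∘ₗ Matrix.diagLinearMap n K K) with hΦd
  -- `(Ad_t − 1)` and `(Ad_{t⁻¹} − 1)` on a conjugated matrix unit
  have hAd : ∀ k l : n, (t : Matrix n n K) * ((g : Matrix n n K) * Matrix.single k l (1 : K) * ((g⁻¹ : GL n K) : Matrix n n K)) *
        ((t⁻¹ : GL n K) : Matrix n n K) - (g : Matrix n n K) * Matrix.single k l (1 : K) * ((g⁻¹ : GL n K) : Matrix n n K) =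
      ((((d k) * (d l)⁻¹ : Kˣ) : K) - 1) • ((g : Matrix n n K) * Matrix.single k l (1 : K) * ((g⁻¹ : GL n K) : Matrix n n K)) := by
    intro k l
    rw [ht, hti, conj_mul_conj_mul_conj, hD, hDi, diagonal_mul_single_mul_diagonal, mul_one, sub_smul, one_smul, ← Units.val_mul,
      ← Matrix.smul_mul, ← Matrix.mul_smul, Matrix.smul_single, smul_eq_mul, mul_one]
  have hAdi : ∀ k l : n, ((t⁻¹ : GL n K) : Matrix n n K) * ((g : Matrix n n K) * Matrix.single k l (1 : K) * ((g⁻¹ : GL n K) : Matrix n n K)) *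
        (t : Matrix n n K) - (g : Matrix n n K) * Matrix.single k l (1 : K) * ((g⁻¹ : GL n K) : Matrix n n K) =
      ((((d k)⁻¹ * (d l) : Kˣ) : K) - 1) • ((g : Matrix n n K) * Matrix.single k l (1 : K) * ((g⁻¹ : GL n K) : Matrix n n K)) := by
    intro k l
    rw [ht, hti, conj_mul_conj_mul_conj, hD, hDi, diagonal_mul_single_mul_diagonal, mul_one, sub_smul, one_smul, ← Units.val_mul,
      ← Matrix.smul_mul, ← Matrix.mul_smul, Matrix.smul_single, smul_eq_mul, mul_one]
  -- `Φ` agrees with `e ∘ Φ_d ∘ e⁻¹` on the conjugated matrix units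
  have hΦ : ∀ k l : n, Φ (e (Matrix.single k l (1 : K))) = e (Φd (Matrix.single k l (1 : K))) := by
    intro k l
    rw [hΦd, phi_single, map_smul]
    change Φ ((g : Matrix n n K) * Matrix.single k l (1 : K) * ((g⁻¹ : GL n K) : Matrix n n K)) =
      _ • ((g : Matrix n n K) * Matrix.single k l (1 : K) * ((g⁻¹ : GL n K) : Matrix n n K))
    by_cases hkl : k = l
    · -- a diagonal unit commutes with `t`
      subst hkl
      try rw [if_pos rfl]
      rw [inv_mul_cancel, Units.val_one, sub_add_cancel, one_smul]
      apply h2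
      rw [ht]
      calc (g : Matrix n n K) * Matrix.single k k (1 : K) * ((g⁻¹ : GL n K) : Matrix n n K) * ((g : Matrix n n K) * D * ((g⁻¹ : GL n K) : Matrix n n K))
          = (g : Matrix n n K) * 1 * ((g⁻¹ : GL n K) : Matrix n n K) * ((g : Matrix n n K) * Matrix.single k k (1 : K) * ((g⁻¹ : GL n K) : Matrix n n K)) *
              ((g : Matrix n n K) * D * ((g⁻¹ : GL n K) : Matrix n n K)) := by rw [Matrix.mul_one, hgi, Matrix.one_mul]
        _ = (g : Matrix n n K) * (1 * Matrix.single k k (1 : K) * D) * ((g⁻¹ : GL n K) : Matrix n n K) := conj_mul_conj_mul_conj g _ _ _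
        _ = (g : Matrix n n K) * (D * Matrix.single k k (1 : K) * 1) * ((g⁻¹ : GL n K) : Matrix n n K) := by
              rw [← diagonal_one, hD, diagonal_mul_single_mul_diagonal, diagonal_mul_single_mul_diagonal, one_mul, mul_one, mul_one, one_mul]
        _ = (g : Matrix n n K) * D * ((g⁻¹ : GL n K) : Matrix n n K) * ((g : Matrix n n K) * Matrix.single k k (1 : K) * ((g⁻¹ : GL n K) : Matrix n n K)) *
              ((g : Matrix n n K) * 1 * ((g⁻¹ : GL n K) : Matrix n n K)) := (conj_mul_conj_mul_conj g _ _ _).symm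
        _ = (g : Matrix n n K) * D * ((g⁻¹ : GL n K) : Matrix n n K) * ((g : Matrix n n K) * Matrix.single k k (1 : K) * ((g⁻¹ : GL n K) : Matrix n n K)) := by
              rw [Matrix.mul_one, hgi, Matrix.mul_one]
    · -- an off-diagonal unit is an `(Ad_t − 1)`-image
      rw [if_neg hkl, add_zero]
      have hne : (((d k) * (d l)⁻¹ : Kˣ) : K) - 1 ≠ 0 := by
        intro h0
        apply hkl
        apply hd
        have h1' : ((d k) * (d l)⁻¹ : Kˣ) = 1 := Units.ext (by rw [Units.val_one]; exact sub_eq_zero.1 h0)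
        exact mul_inv_eq_one.1 h1'
      set E := (g : Matrix n n K) * Matrix.single k l (1 : K) * ((g⁻¹ : GL n K) : Matrix n n K) with hE
      -- `E = (Ad_t − 1) (a • E)` with `a = (d_k d_l⁻¹ − 1)⁻¹`
      have hpre : ((LinearMap.mulLeftRight K ((t : Matrix n n K), ((t⁻¹ : GL n K) : Matrix n n K)) - LinearMap.id :
          Matrix n n K →ₗ[K] Matrix n n K) (((((d k) * (d l)⁻¹ : Kˣ) : K) - 1)⁻¹ • E)) = E := by
        rw [LinearMap.sub_apply, LinearMap.mulLeftRight_apply, LinearMap.id_apply, Matrix.mul_smul, Matrix.smul_mul, ← smul_sub, hE, hAd,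
          smul_smul, inv_mul_cancel₀ hne, one_smul]
      have key := congrArg (fun f : Matrix n n K →ₗ[K] Matrix n n K => f (((((d k) * (d l)⁻¹ : Kˣ) : K) - 1)⁻¹ • E)) h1
      simp only [LinearMap.coe_comp, Function.comp_apply] at key
      rw [hpre] at key
      rw [key, LinearMap.sub_apply, LinearMap.mulLeftRight_apply, LinearMap.id_apply, hE, hAdi]
  -- hence `Φ = e ∘ Φ_d ∘ e⁻¹` and the determinants agree
  have hcomp : Φ ∘ₗ (e : Matrix n n K →ₗ[K] Matrix n n K) = (e : Matrix n n K →ₗ[K] Matrix n n K) ∘ₗ Φd := by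
    refine (Matrix.stdBasis K n n).ext fun p => ?_
    rw [LinearMap.coe_comp, Function.comp_apply, LinearMap.coe_comp, Function.comp_apply, Matrix.stdBasis_eq_single]
    exact hΦ p.1 p.2
  have hΦe : Φ = (e : Matrix n n K →ₗ[K] Matrix n n K) ∘ₗ Φd ∘ₗ (e.symm : Matrix n n K →ₗ[K] Matrix n n K) := by
    rw [← LinearMap.comp_assoc, ← hcomp, LinearMap.comp_assoc, LinearEquiv.comp_symm, LinearMap.comp_id]
  rw [hΦe, LinearMap.det_conj, hΦd, det_phi_diagonal]

end AnyField

/-! ## §2 `n = 3`: the product is `−disc(χ_t) ∕ det(t)²` -/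

section Three

variable {K : Type*} [Field K]

/-- **The `Fin 3` scalar identity**: `∏_{(k,l)} (d_k⁻¹ d_l − 1 + [k = l]) = −((d₀−d₁)(d₀−d₂)(d₁−d₂))² ∕ (d₀d₁d₂)²` (`= ∏_{k≠l}(d_k⁻¹d_l − 1)`; each unordered pair
contributes `−(d_k − d_l)² ∕ (d_k d_l)`). [cite: HarishChandra1970, Lemma 22] [cite: Rogawski1990, §4.9 p. 54] -/
theorem prod_phi_eigenvalues_fin_three (d : Fin 3 → Kˣ) :
    (∏ p : Fin 3 × Fin 3, ((((d p.1)⁻¹ * d p.2 : Kˣ) : K) - 1 + if p.1 = p.2 then 1 else 0)) =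
      -(((d 0 : K) - d 1) * ((d 0 : K) - d 2) * ((d 1 : K) - d 2)) ^ 2 / ((d 0 : K) * d 1 * d 2) ^ 2 := by
  have h0 : ((d 0 : Kˣ) : K) ≠ 0 := (d 0).ne_zero
  have h1 : ((d 1 : Kˣ) : K) ≠ 0 := (d 1).ne_zero
  have h2 : ((d 2 : Kˣ) : K) ≠ 0 := (d 2).ne_zero
  rw [Fintype.prod_prod_type]
  simp only [Fin.prod_univ_three, Units.val_mul, Units.val_inv_eq_inv_val]
  have e01 : ((0 : Fin 3) = 1) = False := by decide
  have e02 : ((0 : Fin 3) = 2) = False := by decide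
  have e10 : ((1 : Fin 3) = 0) = False := by decide
  have e12 : ((1 : Fin 3) = 2) = False := by decide
  have e20 : ((2 : Fin 3) = 0) = False := by decide
  have e21 : ((2 : Fin 3) = 1) = False := by decide
  simp only [e01, e02, e10, e12, e20, e21, if_true, if_false, add_zero]
  field_simp
  ring

/-- **The diagonal split case of C7's determinant**: for a REGULAR diagonal `t = diag(d) ∈ GL₃(K)`, the regularised operator
`Φ_t = (Ad_{t⁻¹} − 1) + (projection onto the diagonal = 𝔷(t) along the off-diagonal = (Ad_t − 1)M₃(K))` has
`det Φ_t = −disc(χ_t) ∕ det(t)²` — i.e. `det((Ad_{t⁻¹} − 1)|_{𝔪}) = ∏_{i≠j}(λᵢ⁻¹λⱼ − 1) = −disc∕det²`, the Jacobian weight `|det(1 − Ad t)|_{𝔤∕𝔱}` before taking absolute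
values. [cite: HarishChandra1970, Lemma 22] [cite: Rogawski1990, §4.9 p. 54] -/
theorem det_phi_diagonal_fin_three (d : Fin 3 → Kˣ) :
    LinearMap.det ((LinearMap.mulLeftRight K ((diagonal fun i => (((d i)⁻¹ : Kˣ) : K)), diagonal fun i => ((d i : Kˣ) : K)) - LinearMap.id +
        (Matrix.diagonalLinearMap (Fin 3) K K ∘ₗ Matrix.diagLinearMap (Fin 3) K K) : Matrix (Fin 3) (Fin 3) K →ₗ[K] Matrix (Fin 3) (Fin 3) K)) =
      -((diagonal fun i => ((d i : Kˣ) : K)).charpoly.discr) / ((diagonal fun i => ((d i : Kˣ) : K)).det) ^ 2 := by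
  obtain ⟨hdisc, hdet⟩ := F0P3cStCharTSVanDijkHC.discr_charpoly_and_det_of_eq_diagonal (diagonal fun i => ((d i : Kˣ) : K)) (fun i => ((d i : Kˣ) : K)) rfl
  rw [det_phi_diagonal, prod_phi_eigenvalues_fin_three, hdisc, hdet]

/-- **C7, SPLIT CASE, `n = 3`: `det Φ = −disc(χ_t) ∕ det(t)²`** for `t = g · diag(d) · g⁻¹ ∈ GL₃(K)` regular (distinct `dᵢ`) and any regularised Jacobian operator `Φ`
(`Ad_{t⁻¹} − 1` on `(Ad_t − 1)M₃(K)`, identity on `𝔷(t)`): the determinant of the linear part of the tube map at `t` is the conjugation-invariant scalar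
`∏_{i≠j}(λᵢ⁻¹λⱼ − 1) = −disc(χ_t)∕det(t)²` (★ `Matrix.charpoly_units_conj`, `Matrix.det_conj`). [cite: HarishChandra1970, Lemma 22] [cite: Rogawski1990, §4.9 p. 54; §12.5 p. 182] -/
theorem det_eq_neg_discr_div_det_sq_of_eq_conj_diagonal (t g : GL (Fin 3) K) (d : Fin 3 → Kˣ) (hd : Function.Injective d)
    (ht : (t : Matrix (Fin 3) (Fin 3) K) = (g : Matrix (Fin 3) (Fin 3) K) * diagonal (fun i => ((d i : Kˣ) : K)) * ((g⁻¹ : GL (Fin 3) K) : Matrix (Fin 3) (Fin 3) K))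
    (Φ : Matrix (Fin 3) (Fin 3) K →ₗ[K] Matrix (Fin 3) (Fin 3) K)
    (h1 : Φ ∘ₗ (LinearMap.mulLeftRight K ((t : Matrix (Fin 3) (Fin 3) K), ((t⁻¹ : GL (Fin 3) K) : Matrix (Fin 3) (Fin 3) K)) - LinearMap.id) =
      (LinearMap.mulLeftRight K (((t⁻¹ : GL (Fin 3) K) : Matrix (Fin 3) (Fin 3) K), (t : Matrix (Fin 3) (Fin 3) K)) - LinearMap.id) ∘ₗ
        (LinearMap.mulLeftRight K ((t : Matrix (Fin 3) (Fin 3) K), ((t⁻¹ : GL (Fin 3) K) : Matrix (Fin 3) (Fin 3) K)) - LinearMap.id))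
    (h2 : ∀ Z : Matrix (Fin 3) (Fin 3) K, Z * (t : Matrix (Fin 3) (Fin 3) K) = (t : Matrix (Fin 3) (Fin 3) K) * Z → Φ Z = Z) :
    LinearMap.det Φ = -((t : Matrix (Fin 3) (Fin 3) K).charpoly.discr) / ((t : Matrix (Fin 3) (Fin 3) K).det) ^ 2 := by
  obtain ⟨hdisc, hdet⟩ := F0P3cStCharTSVanDijkHC.discr_charpoly_and_det_of_eq_diagonal (diagonal fun i => ((d i : Kˣ) : K)) (fun i => ((d i : Kˣ) : K)) rfl
  have hch : (t : Matrix (Fin 3) (Fin 3) K).charpoly = (diagonal fun i => ((d i : Kˣ) : K)).charpoly := by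
    rw [ht, Matrix.coe_units_inv]; exact Matrix.charpoly_units_conj g _
  have hdt : (t : Matrix (Fin 3) (Fin 3) K).det = (diagonal fun i => ((d i : Kˣ) : K)).det := by
    rw [ht, Matrix.coe_units_inv]; exact Matrix.det_conj g.isUnit _
  rw [det_eq_prod_of_eq_conj_diagonal t g d hd ht Φ h1 h2, prod_phi_eigenvalues_fin_three, hch, hdt, hdisc, hdet]

end Three

end Summit.HodgeConjecture.HodgeConjecture.Cruxes.H413.F0P3cStCharTSAdRegularisedDet

end
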